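import Literature.AlgebraicGeometry.Motives.AbelianVarietyDihedralOrderEightBrauerRelations
import HarnessLib

/-!
# The Brauer relation lattice of the dihedral group `D_6 ≅ C_2 × S_3` of order `12` in full: rank `4`, a ℤ-basis of
# INDUCED and LIFTED relations — `Prim(D_6) = 0` (Bartel–Dokchitser, Theorem A, table case 4b with `p = 2`)

Layer A1/A2 of the Hodge foundations lane (`lit-hodgefound`, row A1-20⁺ · A2, seat p03 generation 28, row g28-#12) on
the ALGEBRAIC carrier; sequel of `Motives/AbelianVarietyDihedralOrderEightBrauerRelations` (g28-#2; same method;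
CONSUMED: `indClassFun_one_apply_eq_div`, `card_conj_mem_bot`, `indClassFun_top_one`,
`mem_ker_linearCombination_indClassFun_one_iff`); the Kani–Rosen isogenies of dihedral relations are the tree's
`Motives/AbelianVarietyDihedralIdempotentRelations` / `…DihedralKleinPrym…` files (CITED, nothing restated).  With
`A_4` (g28-#9) and `Dic_3` (g28-#11) this completes `K(G)` for the three non-abelian groups of order `12`.
`D_6 = ⟨σ, τ | σ⁶ = τ² = 1, τστ = σ⁻¹⟩ = C_3 ⋊ (C_2 × C_2) ≅ C_2 × S_3` (Mathlib's `DihedralGroup 6`, `σ = r 1`,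
`τ = sr 0`) has TEN classes of subgroups: `1, Z = ⟨σ³⟩ = Z(G), C_2 = ⟨τ⟩, C_2' = ⟨στ⟩ (the two classes of
reflections, `sr (even)` and `sr (odd)`), C_3 = ⟨σ²⟩, C_6 = ⟨σ⟩, V = ⟨τ, σ³⟩ = C(τ) (ONE class of Klein four-groups:
each contains one reflection of each class), S_3 = ⟨σ², τ⟩, S_3' = ⟨σ², στ⟩ (both normal), D_6`; six are cyclic, so
(Bartel–Dokchitser §2) **`rank K(D_6) = 4`**.  The six class equations solved (§3): **`a ∈ K(D_6)` iff
`a_{C_2'} = −2a_1 − a_{C_2}`, `a_{C_6} = −a_1 − a_Z − a_{C_3}`, `a_V = −2a_Z`, `a_{S_3} = −a_1 − a_{C_2} − a_{C_3}`,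
`a_{S_3'} = a_1 + a_{C_2} − a_{C_3}`, `a_G = 2a_1 + 2a_Z + 2a_{C_3}`**, and a **ℤ-basis of imprimitive relations**:
`Ind_V = 1 − Z − C_2 − C_2' + 2V` (Example 3 induced from `V ≅ C_2²`), `Ind_{S_3} = 1 − 2C_2 − C_3 + 2S_3` (Example 2
induced), `Inf_{C_3} = C_3 − C_6 − S_3 − S_3' + 2G` (Example 3 lifted from `D_6/C_3 ≅ C_2²`),
`Inf_Z = Z − 2V − C_6 + 2G` (Example 2 lifted from `D_6/Z ≅ S_3`) — so **every Brauer relation of `D_6` is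
imprimitive, `Prim(D_6) = 0`**, consistent with Theorem A's table: `D_6 = C ⋊ P` with `C = C_3`, `P = ⟨τ⟩ × K`,
`K = ker(P → Aut C) = Z ≅ C_2`, is case 4b with `p = 2`, where `Prim(G) ≅ (ℤ/pℤ)^{p−2} = 0`; likewise for the
dicyclic `Dic_3 = C_3 ⋊ C_4` of g28-#11 (`K ≅ C_2` but `P = C_4` NOT a direct product by `K`: case 4c, where the
vertex set `ℋ_m` of the graph `Γ` — the subgroups of `P` of maximal size meeting `Z(K)` trivially — is `{1}`, so
`d = 1` and `Prim ≅ (ℤ/pℤ)^{d−1} = 0`, as computed there).  (The other induced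
relation `Ind_{S_3'} = 1 − 2C_2' − C_3 + 2S_3'` equals `2Ind_V − Ind_{S_3} − 2Inf_{C_3} + 2Inf_Z`.)  Everything here is
PROVED; NO definition, NO named fact (net Literature debt 0).

## Sources, verbatim

A. Bartel, T. Dokchitser, *Brauer relations in finite groups*, J. Eur. Math. Soc. **17** (2015) (arXiv 1103.2047, held
`paper:arxiv-1103.2047`).  §1.1 Theorem A (4) (p0003): "`G = C ⋊ P` is quasi-elementary, `P` is a `p`-group,
`|C| = l_1⋯l_t` with `l_i ≠ p` distinct primes, the kernel `K = ker(P → Aut C)` has normal `p`-rank one […] or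
`K ≅ C_p`, `P` is a direct product of a group with faithful action on `C` by `K`, and […]"; table (p0004), case 4b:
"`(ℤ/pℤ)^{p−2}`".  §2 (p0006): Induction, Inflation ("if `N ◁ G`, then a `G/N`-relation can be lifted to a
`G`-relation"), "the rank of `K(G)` is the number of conjugacy classes of non-cyclic subgroups", Example 2 (`S_3`),
Example 3 (`C_p × C_p`: `1 − Σ_C C + pG`).  Table case 4c (p0004): "`(ℤ/pℤ)^{d−1}`, `d = #` connected components
of `Γ`", with `Γ` the graph of the quasi-elementary theorem (arXiv p. 20): "Assume that either `|K| > p`, or `P` is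
not a direct product by `K`. Let `ℋ_m` be the set of subgroups of `P` of maximal size among those that intersect
the centre of `K` trivially […] Then `Prim(G) ≅ (C_p)^{d−1}`".

## Dictionary and what is proved (namespace `Literature.AlgebraicGeometry.Motives.AbelianVariety`)

Representatives (indices `0…9`): `![⊥, zpowers (r 3), zpowers (sr 0), zpowers (sr 1), zpowers (r 2), zpowers (r 1),
centralizer {sr 0}, zpowers (sr 0) ⊔ zpowers (r 2), zpowers (sr 1) ⊔ zpowers (r 2), ⊤]`; classes `{1}`, `{σ³}`,
`{σ, σ⁵}`, `{σ², σ⁴}`, `{τ, σ²τ, σ⁴τ} = {sr 0, sr 2, sr 4}`, `{sr 1, sr 3, sr 5}` written as explicit disjunctions;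
`𝒦` any `Submodule ℤ (Fin 10 → ℤ)` with `a ∈ 𝒦 ↔ Σ_i a_i (1_{H_i})^G = 0`.

* §1 `orderOf_r_three_r_two_dihedralSix`, `mem_centralizer_sr_zero_dihedralSix_iff` (`V = C(τ) = {1, σ³, τ, σ³τ}`),
  `mem_sup_sr_zero_r_two_dihedralSix_iff`, `mem_sup_sr_one_r_two_dihedralSix_iff` (the two `S_3`'s),
  `natCard_subgroups_dihedralSix`.
* §2 `card_conj_mem_*_dihedralSix` (eight marks functions), **`indClassFun_one_apply_dihedralSix`**.
* §3 `sum_smul_indClassFun_dihedralSix_apply`, **`sum_smul_indClassFun_dihedralSix_eq_zero_iff`**,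
  **`relations_mem_dihedralSix`** (the five induced/lifted relations as a `Fin 5`-family),
  `indS3'_eq_combination_dihedralSix`.
* §4 `mem_brauerRelations_dihedralSix_iff`, **`eq_combination_of_mem_brauerRelations_dihedralSix`**,
  **`brauerRelations_dihedralSix_eq_span`** (`K(D_6) = ℤInd_V ⊕ ℤInd_{S_3} ⊕ ℤInf_{C_3} ⊕ ℤInf_Z`: all imprimitive),
  `linearIndependent_basis_dihedralSix`, `ker_linearCombination_indClassFun_one_dihedralSix_eq_span`,
  **`finrank_ker_linearCombination_indClassFun_one_dihedralSix`** (`= 4`).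

## References

* [BartelDokchitser2015] A. Bartel, T. Dokchitser, *Brauer relations in finite groups*, JEMS 17 (2015), §1.1 Theorem A
  (4) and table case 4b, §2 (Induction, Inflation, rank, Examples 2–3).
-/

noncomputable section

universe u

open CategoryTheory CategoryTheory.Limits
open Literature.RepresentationTheory.FiniteGroups

namespace Literature.AlgebraicGeometry.Motives

namespace AbelianVariety

open DihedralGroup

/-! ## §1 `D_6 = DihedralGroup 6`: orders, `V = C(τ)`, the two `S_3`'s -/

section DihedralSixGroup

/-- `σ³` has order `2` (`⟨σ³⟩ = Z(D_6)`), `σ²` has order `3`. [cite: BartelDokchitser2015, §2 ("cyclic subgroups")] -/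
theorem orderOf_r_three_r_two_dihedralSix :
    orderOf (r 3 : DihedralGroup 6) = 2 ∧ orderOf (r 2 : DihedralGroup 6) = 3 := by
  refine ⟨?_, ?_⟩
  · rw [orderOf_eq_prime_iff (p := 2)]
    decide
  · haveI : Fact (Nat.Prime 3) := ⟨Nat.prime_three⟩
    rw [orderOf_eq_prime_iff (p := 3)]
    decide

/-- `y ∈ ⟨g⟩ ↔ y ∈ {g^k : k < orderOf g}`. [folklore] -/
private theorem mem_zpowers_d6_iff (g : DihedralGroup 6) {m : ℕ} (hm : orderOf g = m) (y : DihedralGroup 6) :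
    y ∈ Subgroup.zpowers g ↔ y ∈ (Finset.range m).image (g ^ ·) := by
  rw [mem_zpowers_iff_mem_range_orderOf, hm]

/-- **`y ∈ V = C(τ) ↔ τy = yτ`** (`V = {1, σ³, τ, σ³τ}`, a Klein four-group). [cite: BartelDokchitser2015, §2 (Example 3)] -/
theorem mem_centralizer_sr_zero_dihedralSix_iff (y : DihedralGroup 6) :
    y ∈ Subgroup.centralizer ({(sr 0 : DihedralGroup 6)} : Set (DihedralGroup 6)) ↔ sr 0 * y = y * sr 0 := by
  rw [Subgroup.mem_centralizer_iff]
  simp only [Set.mem_singleton_iff, forall_eq]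

/-- `⟨σ²⟩ ⊴ D_6`. [folklore] -/
private theorem normal_zpowers_r_two_dihedralSix : (Subgroup.zpowers (r 2 : DihedralGroup 6)).Normal := by
  refine ⟨fun y hy g ↦ ?_⟩
  rw [mem_zpowers_d6_iff _ orderOf_r_three_r_two_dihedralSix.2] at hy ⊢
  revert hy
  revert y g
  decide

/-- **`y ∈ S_3 = ⟨τ⟩ ⊔ ⟨σ²⟩ ↔ y = τ^a σ^{2b}`** (`a < 2`, `b < 3`). [cite: BartelDokchitser2015, §2 (Example 2)] -/
theorem mem_sup_sr_zero_r_two_dihedralSix_iff (y : DihedralGroup 6) :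
    y ∈ (Subgroup.zpowers (sr 0 : DihedralGroup 6) ⊔ Subgroup.zpowers (r 2 : DihedralGroup 6)) ↔
      ∃ h ∈ (Finset.range 2).image ((sr 0 : DihedralGroup 6) ^ ·),
        ∃ k ∈ (Finset.range 3).image ((r 2 : DihedralGroup 6) ^ ·), h * k = y := by
  haveI := normal_zpowers_r_two_dihedralSix
  rw [Subgroup.mem_sup_of_normal_right]
  simp only [mem_zpowers_d6_iff _ (orderOf_sr 0), mem_zpowers_d6_iff _ orderOf_r_three_r_two_dihedralSix.2]

/-- **`y ∈ S_3' = ⟨στ⟩ ⊔ ⟨σ²⟩ ↔ y = (sr 1)^a σ^{2b}`.** [cite: BartelDokchitser2015, §2 (Example 2)] -/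
theorem mem_sup_sr_one_r_two_dihedralSix_iff (y : DihedralGroup 6) :
    y ∈ (Subgroup.zpowers (sr 1 : DihedralGroup 6) ⊔ Subgroup.zpowers (r 2 : DihedralGroup 6)) ↔
      ∃ h ∈ (Finset.range 2).image ((sr 1 : DihedralGroup 6) ^ ·),
        ∃ k ∈ (Finset.range 3).image ((r 2 : DihedralGroup 6) ^ ·), h * k = y := by
  haveI := normal_zpowers_r_two_dihedralSix
  rw [Subgroup.mem_sup_of_normal_right]
  simp only [mem_zpowers_d6_iff _ (orderOf_sr 1), mem_zpowers_d6_iff _ orderOf_r_three_r_two_dihedralSix.2]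

end DihedralSixGroup

/-! ## §2 The marks and the ten permutation characters, machine-checked -/

section DihedralSixMarks

/-- `|{y : Q y}|` as a filter cardinality. [folklore] -/
private theorem natCard_subtype_eq_card_filter_d6 (P : DihedralGroup 6 → Prop) [DecidablePred P]
    (Q : DihedralGroup 6 → Prop) (hQP : ∀ y, Q y ↔ P y) :
    Nat.card {y : DihedralGroup 6 // Q y} = (Finset.univ.filter P).card := by
  rw [← Fintype.card_subtype, ← Nat.card_eq_fintype_card]
  exact Nat.card_congr (Equiv.subtypeEquivRight hQP)

/-- **Marks of `Z = ⟨σ³⟩`**: `12·[g ∈ Z]`. [cite: BartelDokchitser2015, §2] -/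
theorem card_conj_mem_r_three_dihedralSix (g : DihedralGroup 6) :
    Nat.card {y : DihedralGroup 6 // y⁻¹ * g * y ∈ Subgroup.zpowers (r 3 : DihedralGroup 6)} =
      if (g = 1 ∨ g = r 3) then 12 else 0 := by
  classical
  rw [natCard_subtype_eq_card_filter_d6 _ _ fun y ↦ mem_zpowers_d6_iff _ orderOf_r_three_r_two_dihedralSix.1 _]
  revert g
  decide

/-- **Marks of `C_2 = ⟨τ⟩`**: `12` at `1`, `4` on `{τ, σ²τ, σ⁴τ}`. [cite: BartelDokchitser2015, §2] -/
theorem card_conj_mem_sr_zero_dihedralSix (g : DihedralGroup 6) :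
    Nat.card {y : DihedralGroup 6 // y⁻¹ * g * y ∈ Subgroup.zpowers (sr 0 : DihedralGroup 6)} =
      if g = 1 then 12 else if (g = sr 0 ∨ g = sr 2 ∨ g = sr 4) then 4 else 0 := by
  classical
  rw [natCard_subtype_eq_card_filter_d6 _ _ fun y ↦ mem_zpowers_d6_iff _ (orderOf_sr 0) _]
  revert g
  decide

/-- **Marks of `C_2' = ⟨στ⟩`**: `12` at `1`, `4` on `{sr 1, sr 3, sr 5}`. [cite: BartelDokchitser2015, §2] -/
theorem card_conj_mem_sr_one_dihedralSix (g : DihedralGroup 6) :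
    Nat.card {y : DihedralGroup 6 // y⁻¹ * g * y ∈ Subgroup.zpowers (sr 1 : DihedralGroup 6)} =
      if g = 1 then 12 else if (g = sr 1 ∨ g = sr 3 ∨ g = sr 5) then 4 else 0 := by
  classical
  rw [natCard_subtype_eq_card_filter_d6 _ _ fun y ↦ mem_zpowers_d6_iff _ (orderOf_sr 1) _]
  revert g
  decide

/-- **Marks of `C_3 = ⟨σ²⟩ ⊴ D_6`**: `12·[g ∈ C_3]`. [cite: BartelDokchitser2015, §2] -/
theorem card_conj_mem_r_two_dihedralSix (g : DihedralGroup 6) :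
    Nat.card {y : DihedralGroup 6 // y⁻¹ * g * y ∈ Subgroup.zpowers (r 2 : DihedralGroup 6)} =
      if g = 1 ∨ (g = r 2 ∨ g = r 4) then 12 else 0 := by
  classical
  rw [natCard_subtype_eq_card_filter_d6 _ _ fun y ↦ mem_zpowers_d6_iff _ orderOf_r_three_r_two_dihedralSix.2 _]
  revert g
  decide

/-- **Marks of `C_6 = ⟨σ⟩ ⊴ D_6`**: `12` on rotations. [cite: BartelDokchitser2015, §2] -/
theorem card_conj_mem_r_one_dihedralSix (g : DihedralGroup 6) :
    Nat.card {y : DihedralGroup 6 // y⁻¹ * g * y ∈ Subgroup.zpowers (r 1 : DihedralGroup 6)} =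
      if (g = 1 ∨ g = r 3) ∨ (g = r 1 ∨ g = r 5) ∨ (g = r 2 ∨ g = r 4) then 12 else 0 := by
  classical
  rw [natCard_subtype_eq_card_filter_d6 _ _ fun y ↦ mem_zpowers_d6_iff _ orderOf_r_one _]
  revert g
  decide

/-- **Marks of `V = C(τ)`**: `12` on `Z`, `4` on reflections. [cite: BartelDokchitser2015, §2 (Example 3)] -/
theorem card_conj_mem_centralizer_sr_zero_dihedralSix (g : DihedralGroup 6) :
    Nat.card {y : DihedralGroup 6 // y⁻¹ * g * y ∈ Subgroup.centralizer ({(sr 0 : DihedralGroup 6)} : Set (DihedralGroup 6))} =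
      if (g = 1 ∨ g = r 3) then 12 else if (g = sr 0 ∨ g = sr 2 ∨ g = sr 4) ∨ (g = sr 1 ∨ g = sr 3 ∨ g = sr 5) then 4 else 0 := by
  classical
  rw [natCard_subtype_eq_card_filter_d6 _ _ fun y ↦ mem_centralizer_sr_zero_dihedralSix_iff _]
  revert g
  decide

/-- **Marks of `S_3 = ⟨τ, σ²⟩ ⊴ D_6`**: `12·[g ∈ S_3]`. [cite: BartelDokchitser2015, §2 (Example 2)] -/
theorem card_conj_mem_sup_sr_zero_dihedralSix (g : DihedralGroup 6) :
    Nat.card {y : DihedralGroup 6 // y⁻¹ * g * y ∈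
        (Subgroup.zpowers (sr 0 : DihedralGroup 6) ⊔ Subgroup.zpowers (r 2 : DihedralGroup 6))} =
      if g = 1 ∨ (g = r 2 ∨ g = r 4) ∨ (g = sr 0 ∨ g = sr 2 ∨ g = sr 4) then 12 else 0 := by
  classical
  rw [natCard_subtype_eq_card_filter_d6 _ _ fun y ↦ mem_sup_sr_zero_r_two_dihedralSix_iff _]
  revert g
  decide

/-- **Marks of `S_3' = ⟨στ, σ²⟩ ⊴ D_6`**: `12·[g ∈ S_3']`. [cite: BartelDokchitser2015, §2 (Example 2)] -/
theorem card_conj_mem_sup_sr_one_dihedralSix (g : DihedralGroup 6) :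
    Nat.card {y : DihedralGroup 6 // y⁻¹ * g * y ∈
        (Subgroup.zpowers (sr 1 : DihedralGroup 6) ⊔ Subgroup.zpowers (r 2 : DihedralGroup 6))} =
      if g = 1 ∨ (g = r 2 ∨ g = r 4) ∨ (g = sr 1 ∨ g = sr 3 ∨ g = sr 5) then 12 else 0 := by
  classical
  rw [natCard_subtype_eq_card_filter_d6 _ _ fun y ↦ mem_sup_sr_one_r_two_dihedralSix_iff _]
  revert g
  decide

/-- The orders `2, 2, 2, 3, 6, 4, 6, 6` of `Z, C_2, C_2', C_3, C_6, V, S_3, S_3'`. [cite: BartelDokchitser2015, §2] -/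
theorem natCard_subgroups_dihedralSix :
    Nat.card (Subgroup.zpowers (r 3 : DihedralGroup 6)) = 2 ∧ Nat.card (Subgroup.zpowers (sr 0 : DihedralGroup 6)) = 2 ∧
    Nat.card (Subgroup.zpowers (sr 1 : DihedralGroup 6)) = 2 ∧ Nat.card (Subgroup.zpowers (r 2 : DihedralGroup 6)) = 3 ∧
    Nat.card (Subgroup.zpowers (r 1 : DihedralGroup 6)) = 6 ∧
    Nat.card ↥(Subgroup.centralizer ({(sr 0 : DihedralGroup 6)} : Set (DihedralGroup 6))) = 4 ∧
    Nat.card ↥(Subgroup.zpowers (sr 0 : DihedralGroup 6) ⊔ Subgroup.zpowers (r 2 : DihedralGroup 6)) = 6 ∧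
    Nat.card ↥(Subgroup.zpowers (sr 1 : DihedralGroup 6) ⊔ Subgroup.zpowers (r 2 : DihedralGroup 6)) = 6 := by
  classical
  refine ⟨?_, ?_, ?_, ?_, ?_, ?_, ?_, ?_⟩
  · rw [Nat.card_zpowers, orderOf_r_three_r_two_dihedralSix.1]
  · rw [Nat.card_zpowers, orderOf_sr]
  · rw [Nat.card_zpowers, orderOf_sr]
  · rw [Nat.card_zpowers, orderOf_r_three_r_two_dihedralSix.2]
  · rw [Nat.card_zpowers, orderOf_r_one]
  · show Nat.card {y : DihedralGroup 6 // y ∈ Subgroup.centralizer ({(sr 0 : DihedralGroup 6)} : Set (DihedralGroup 6))} = 4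
    rw [natCard_subtype_eq_card_filter_d6 _ (· ∈ Subgroup.centralizer ({(sr 0 : DihedralGroup 6)} : Set (DihedralGroup 6)))
      mem_centralizer_sr_zero_dihedralSix_iff]
    decide
  · show Nat.card {y : DihedralGroup 6 // y ∈ Subgroup.zpowers (sr 0 : DihedralGroup 6) ⊔ Subgroup.zpowers (r 2 : DihedralGroup 6)} = 6
    rw [natCard_subtype_eq_card_filter_d6 _ (· ∈ Subgroup.zpowers (sr 0 : DihedralGroup 6) ⊔ Subgroup.zpowers (r 2 : DihedralGroup 6))
      mem_sup_sr_zero_r_two_dihedralSix_iff]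
    decide
  · show Nat.card {y : DihedralGroup 6 // y ∈ Subgroup.zpowers (sr 1 : DihedralGroup 6) ⊔ Subgroup.zpowers (r 2 : DihedralGroup 6)} = 6
    rw [natCard_subtype_eq_card_filter_d6 _ (· ∈ Subgroup.zpowers (sr 1 : DihedralGroup 6) ⊔ Subgroup.zpowers (r 2 : DihedralGroup 6))
      mem_sup_sr_one_r_two_dihedralSix_iff]
    decide

/-- **The ten permutation characters of `D_6` as explicit functions** (values on the classes `1, σ³, σ^{±1}, σ^{±2},
τ-class, στ-class: `12,0,0,0,0,0`; `6,6,0,0,0,0`; `6,0,0,0,2,0`; `6,0,0,0,0,2`; `4,0,0,4,0,0`; `2,2,2,2,0,0`;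
`3,3,0,0,1,1`; `2,0,0,2,2,0`; `2,0,0,2,0,2`; `1`). [cite: BartelDokchitser2015, §1.1 ("Θ ∈ K(G) ⟺ Σ_i n_i Ind 1_{H_i} = 0")] -/
theorem indClassFun_one_apply_dihedralSix (g : DihedralGroup 6) :
    indClassFun (⊥ : Subgroup (DihedralGroup 6)) 1 g = (if g = 1 then (12 : ℂ) else 0) ∧
    indClassFun (Subgroup.zpowers (r 3 : DihedralGroup 6)) 1 g = (if (g = 1 ∨ g = r 3) then (6 : ℂ) else 0) ∧
    indClassFun (Subgroup.zpowers (sr 0 : DihedralGroup 6)) 1 g = (if g = 1 then (6 : ℂ) else if (g = sr 0 ∨ g = sr 2 ∨ g = sr 4) then 2 else 0) ∧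
    indClassFun (Subgroup.zpowers (sr 1 : DihedralGroup 6)) 1 g = (if g = 1 then (6 : ℂ) else if (g = sr 1 ∨ g = sr 3 ∨ g = sr 5) then 2 else 0) ∧
    indClassFun (Subgroup.zpowers (r 2 : DihedralGroup 6)) 1 g = (if g = 1 ∨ (g = r 2 ∨ g = r 4) then (4 : ℂ) else 0) ∧
    indClassFun (Subgroup.zpowers (r 1 : DihedralGroup 6)) 1 g = (if (g = 1 ∨ g = r 3) ∨ (g = r 1 ∨ g = r 5) ∨ (g = r 2 ∨ g = r 4) then (2 : ℂ) else 0) ∧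
    indClassFun (Subgroup.centralizer ({(sr 0 : DihedralGroup 6)} : Set (DihedralGroup 6))) 1 g = (if (g = 1 ∨ g = r 3) then (3 : ℂ) else if (g = sr 0 ∨ g = sr 2 ∨ g = sr 4) ∨ (g = sr 1 ∨ g = sr 3 ∨ g = sr 5) then 1 else 0) ∧
    indClassFun (Subgroup.zpowers (sr 0 : DihedralGroup 6) ⊔ Subgroup.zpowers (r 2 : DihedralGroup 6)) 1 g = (if g = 1 ∨ (g = r 2 ∨ g = r 4) ∨ (g = sr 0 ∨ g = sr 2 ∨ g = sr 4) then (2 : ℂ) else 0) ∧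
    indClassFun (Subgroup.zpowers (sr 1 : DihedralGroup 6) ⊔ Subgroup.zpowers (r 2 : DihedralGroup 6)) 1 g = (if g = 1 ∨ (g = r 2 ∨ g = r 4) ∨ (g = sr 1 ∨ g = sr 3 ∨ g = sr 5) then (2 : ℂ) else 0) ∧
    indClassFun (⊤ : Subgroup (DihedralGroup 6)) 1 g = 1 := by
  classical
  obtain ⟨c1, c2, c3, c4, c5, c6, c7, c8⟩ := natCard_subgroups_dihedralSix
  refine ⟨?_, ?_, ?_, ?_, ?_, ?_, ?_, ?_, ?_, ?_⟩
  · rw [indClassFun_one_apply_eq_div, card_conj_mem_bot, Subgroup.card_bot, DihedralGroup.card]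
    split_ifs <;> norm_num
  · rw [indClassFun_one_apply_eq_div, card_conj_mem_r_three_dihedralSix, c1]
    split_ifs <;> norm_num
  · rw [indClassFun_one_apply_eq_div, card_conj_mem_sr_zero_dihedralSix, c2]
    split_ifs <;> norm_num
  · rw [indClassFun_one_apply_eq_div, card_conj_mem_sr_one_dihedralSix, c3]
    split_ifs <;> norm_num
  · rw [indClassFun_one_apply_eq_div, card_conj_mem_r_two_dihedralSix, c4]
    split_ifs <;> norm_num
  · rw [indClassFun_one_apply_eq_div, card_conj_mem_r_one_dihedralSix, c5]
    split_ifs <;> norm_num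
  · rw [indClassFun_one_apply_eq_div, card_conj_mem_centralizer_sr_zero_dihedralSix, c6]
    split_ifs <;> norm_num
  · rw [indClassFun_one_apply_eq_div, card_conj_mem_sup_sr_zero_dihedralSix, c7]
    split_ifs <;> norm_num
  · rw [indClassFun_one_apply_eq_div, card_conj_mem_sup_sr_one_dihedralSix, c8]
    split_ifs <;> norm_num
  · rw [indClassFun_top_one, Pi.one_apply]

end DihedralSixMarks

/-! ## §3 The six class equations; the induced and lifted relations -/

section DihedralSixRelations

/-- The twelve elements. [folklore] -/
private theorem dihedralSix_cases (g : DihedralGroup 6) :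
    g = r 0 ∨ g = r 1 ∨ g = r 2 ∨ g = r 3 ∨ g = r 4 ∨ g = r 5 ∨
      g = sr 0 ∨ g = sr 1 ∨ g = sr 2 ∨ g = sr 3 ∨ g = sr 4 ∨ g = sr 5 := by
  revert g
  decide

/-- A ten-term sum of scalar multiples of functions, evaluated at a point. [folklore] -/
private theorem sum_fin_ten_smul_apply_d6 (a : Fin 10 → ℤ) (F : Fin 10 → DihedralGroup 6 → ℂ) (g : DihedralGroup 6) :
    (∑ i : Fin 10, (a i : ℂ) • F i) g = a 0 * F 0 g + a 1 * F 1 g + a 2 * F 2 g + a 3 * F 3 g + a 4 * F 4 g +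
      a 5 * F 5 g + a 6 * F 6 g + a 7 * F 7 g + a 8 * F 8 g + a 9 * F 9 g := by
  simp [Finset.sum_apply, Fin.sum_univ_succ]
  ring

/-- The signed-sum test on the ten representatives, pointwise. [cite: BartelDokchitser2015, §1.1] -/
theorem sum_smul_indClassFun_dihedralSix_apply (a : Fin 10 → ℤ) (g : DihedralGroup 6) :
    (∑ i : Fin 10, (a i : ℂ) • indClassFun ((![⊥,
        Subgroup.zpowers (r 3 : DihedralGroup 6),
        Subgroup.zpowers (sr 0 : DihedralGroup 6),
        Subgroup.zpowers (sr 1 : DihedralGroup 6),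
        Subgroup.zpowers (r 2 : DihedralGroup 6),
        Subgroup.zpowers (r 1 : DihedralGroup 6),
        Subgroup.centralizer ({(sr 0 : DihedralGroup 6)} : Set (DihedralGroup 6)),
        Subgroup.zpowers (sr 0 : DihedralGroup 6) ⊔ Subgroup.zpowers (r 2 : DihedralGroup 6),
        Subgroup.zpowers (sr 1 : DihedralGroup 6) ⊔ Subgroup.zpowers (r 2 : DihedralGroup 6),
        ⊤] :
        Fin 10 → Subgroup (DihedralGroup 6)) i) 1) g =
      a 0 * (if g = 1 then (12 : ℂ) else 0) + a 1 * (if (g = 1 ∨ g = r 3) then (6 : ℂ) else 0) +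
        a 2 * (if g = 1 then (6 : ℂ) else if (g = sr 0 ∨ g = sr 2 ∨ g = sr 4) then 2 else 0) +
        a 3 * (if g = 1 then (6 : ℂ) else if (g = sr 1 ∨ g = sr 3 ∨ g = sr 5) then 2 else 0) +
        a 4 * (if g = 1 ∨ (g = r 2 ∨ g = r 4) then (4 : ℂ) else 0) +
        a 5 * (if (g = 1 ∨ g = r 3) ∨ (g = r 1 ∨ g = r 5) ∨ (g = r 2 ∨ g = r 4) then (2 : ℂ) else 0) +
        a 6 * (if (g = 1 ∨ g = r 3) then (3 : ℂ) else if (g = sr 0 ∨ g = sr 2 ∨ g = sr 4) ∨ (g = sr 1 ∨ g = sr 3 ∨ g = sr 5) then 1 else 0) +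
        a 7 * (if g = 1 ∨ (g = r 2 ∨ g = r 4) ∨ (g = sr 0 ∨ g = sr 2 ∨ g = sr 4) then (2 : ℂ) else 0) +
        a 8 * (if g = 1 ∨ (g = r 2 ∨ g = r 4) ∨ (g = sr 1 ∨ g = sr 3 ∨ g = sr 5) then (2 : ℂ) else 0) + a 9 := by
  obtain ⟨h0, h1, h2, h3, h4, h5, h6, h7, h8, h9⟩ := indClassFun_one_apply_dihedralSix g
  rw [sum_fin_ten_smul_apply_d6]
  show (a 0 : ℂ) * indClassFun (⊥ : Subgroup (DihedralGroup 6)) 1 g +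
      (a 1 : ℂ) * indClassFun (Subgroup.zpowers (r 3 : DihedralGroup 6)) 1 g +
      (a 2 : ℂ) * indClassFun (Subgroup.zpowers (sr 0 : DihedralGroup 6)) 1 g +
      (a 3 : ℂ) * indClassFun (Subgroup.zpowers (sr 1 : DihedralGroup 6)) 1 g +
      (a 4 : ℂ) * indClassFun (Subgroup.zpowers (r 2 : DihedralGroup 6)) 1 g +
      (a 5 : ℂ) * indClassFun (Subgroup.zpowers (r 1 : DihedralGroup 6)) 1 g +
      (a 6 : ℂ) * indClassFun (Subgroup.centralizer ({(sr 0 : DihedralGroup 6)} : Set (DihedralGroup 6))) 1 g +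
      (a 7 : ℂ) * indClassFun (Subgroup.zpowers (sr 0 : DihedralGroup 6) ⊔ Subgroup.zpowers (r 2 : DihedralGroup 6)) 1 g +
      (a 8 : ℂ) * indClassFun (Subgroup.zpowers (sr 1 : DihedralGroup 6) ⊔ Subgroup.zpowers (r 2 : DihedralGroup 6)) 1 g +
      (a 9 : ℂ) * indClassFun (⊤ : Subgroup (DihedralGroup 6)) 1 g = _
  rw [h0, h1, h2, h3, h4, h5, h6, h7, h8, h9, mul_one]

/-- **The Brauer relations of `D_6`** on `![1, Z, C_2, C_2', C_3, C_6, V, S_3, S_3', D_6]`: `a ∈ K(D_6)` iff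
`a_{C_2'} = −2a_1 − a_{C_2}`, `a_{C_6} = −a_1 − a_Z − a_{C_3}`, `a_V = −2a_Z`, `a_{S_3} = −a_1 − a_{C_2} − a_{C_3}`,
`a_{S_3'} = a_1 + a_{C_2} − a_{C_3}`, `a_G = 2a_1 + 2a_Z + 2a_{C_3}` (free `a_1, a_Z, a_{C_2}, a_{C_3}`: rank `4` = the
non-cyclic classes `V, S_3, S_3', D_6`). [cite: BartelDokchitser2015, §1.1; §2 ("the rank of K(G) is the number of conjugacy classes of non-cyclic subgroups")] -/
theorem sum_smul_indClassFun_dihedralSix_eq_zero_iff (a : Fin 10 → ℤ) :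
    ∑ i : Fin 10, (a i : ℂ) • indClassFun ((![⊥,
        Subgroup.zpowers (r 3 : DihedralGroup 6),
        Subgroup.zpowers (sr 0 : DihedralGroup 6),
        Subgroup.zpowers (sr 1 : DihedralGroup 6),
        Subgroup.zpowers (r 2 : DihedralGroup 6),
        Subgroup.zpowers (r 1 : DihedralGroup 6),
        Subgroup.centralizer ({(sr 0 : DihedralGroup 6)} : Set (DihedralGroup 6)),
        Subgroup.zpowers (sr 0 : DihedralGroup 6) ⊔ Subgroup.zpowers (r 2 : DihedralGroup 6),
        Subgroup.zpowers (sr 1 : DihedralGroup 6) ⊔ Subgroup.zpowers (r 2 : DihedralGroup 6),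
        ⊤] :
        Fin 10 → Subgroup (DihedralGroup 6)) i) 1 = 0 ↔
      a 3 = -2 * a 0 - a 2 ∧ a 5 = -a 0 - a 1 - a 4 ∧ a 6 = -2 * a 1 ∧ a 7 = -a 0 - a 2 - a 4 ∧
        a 8 = a 0 + a 2 - a 4 ∧ a 9 = 2 * a 0 + 2 * a 1 + 2 * a 4 := by
  constructor
  · intro h
    have e := fun g ↦ (sum_smul_indClassFun_dihedralSix_apply a g).symm.trans (congr_fun h g)
    have e0 := e 1
    have e1 := e (r 3)
    have e2 := e (r 1)
    have e3 := e (r 2)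
    have e4 := e (sr 0)
    have e5 := e (sr 1)
    simp (config := { decide := true }) only [Pi.zero_apply, if_true, if_false, mul_zero, add_zero] at e0 e1 e2 e3 e4 e5
    have i0 : ((12 * a 0 + 6 * a 1 + 6 * a 2 + 6 * a 3 + 4 * a 4 + 2 * a 5 + 3 * a 6 + 2 * a 7 + 2 * a 8 + a 9 : ℤ) :
        ℂ) = 0 := by
      push_cast; linear_combination e0
    have i1 : ((6 * a 1 + 2 * a 5 + 3 * a 6 + a 9 : ℤ) : ℂ) = 0 := by push_cast; linear_combination e1
    have i2 : ((2 * a 5 + a 9 : ℤ) : ℂ) = 0 := by push_cast; linear_combination e2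
    have i3 : ((4 * a 4 + 2 * a 5 + 2 * a 7 + 2 * a 8 + a 9 : ℤ) : ℂ) = 0 := by push_cast; linear_combination e3
    have i4 : ((2 * a 2 + a 6 + 2 * a 7 + a 9 : ℤ) : ℂ) = 0 := by push_cast; linear_combination e4
    have i5 : ((2 * a 3 + a 6 + 2 * a 8 + a 9 : ℤ) : ℂ) = 0 := by push_cast; linear_combination e5
    norm_cast at i0 i1 i2 i3 i4 i5
    omega
  · rintro ⟨h3, h5, h6, h7, h8, h9⟩
    funext g
    rw [sum_smul_indClassFun_dihedralSix_apply, Pi.zero_apply, h3, h5, h6, h7, h8, h9]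
    push_cast
    rcases dihedralSix_cases g with rfl | rfl | rfl | rfl | rfl | rfl | rfl | rfl | rfl | rfl | rfl | rfl <;>
    · simp (config := { decide := true }) only [if_true, if_false]
      ring

/-- **The five induced / lifted relations of `D_6`** (a `Fin 5`-family): `0 ↦ Ind_V = 1 − Z − C_2 − C_2' + 2V`,
`1 ↦ Ind_{S_3} = 1 − 2C_2 − C_3 + 2S_3`, `2 ↦ Inf_{C_3} = C_3 − C_6 − S_3 − S_3' + 2G` (from `D_6/C_3 ≅ C_2²`),
`3 ↦ Inf_Z = Z − 2V − C_6 + 2G` (from `D_6/Z ≅ S_3`), `4 ↦ Ind_{S_3'} = 1 − 2C_2' − C_3 + 2S_3'`.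
[cite: BartelDokchitser2015, §2 (Induction, Inflation, Examples 2–3)] -/
theorem relations_mem_dihedralSix (k : Fin 5) :
    ∑ i : Fin 10, (((![![1, -1, -1, -1, 0, 0, 2, 0, 0, 0],
      ![1, 0, -2, 0, -1, 0, 0, 2, 0, 0],
      ![0, 0, 0, 0, 1, -1, 0, -1, -1, 2],
      ![0, 1, 0, 0, 0, -1, -2, 0, 0, 2],
      ![1, 0, 0, -2, -1, 0, 0, 0, 2, 0]] : Fin 5 → Fin 10 → ℤ) k i : ℤ) : ℂ) • indClassFun ((![⊥,
        Subgroup.zpowers (r 3 : DihedralGroup 6),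
        Subgroup.zpowers (sr 0 : DihedralGroup 6),
        Subgroup.zpowers (sr 1 : DihedralGroup 6),
        Subgroup.zpowers (r 2 : DihedralGroup 6),
        Subgroup.zpowers (r 1 : DihedralGroup 6),
        Subgroup.centralizer ({(sr 0 : DihedralGroup 6)} : Set (DihedralGroup 6)),
        Subgroup.zpowers (sr 0 : DihedralGroup 6) ⊔ Subgroup.zpowers (r 2 : DihedralGroup 6),
        Subgroup.zpowers (sr 1 : DihedralGroup 6) ⊔ Subgroup.zpowers (r 2 : DihedralGroup 6),
        ⊤] :
        Fin 10 → Subgroup (DihedralGroup 6)) i) 1 = 0 := by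
  refine (sum_smul_indClassFun_dihedralSix_eq_zero_iff _).2 ?_
  fin_cases k <;> simp

/-- `Ind_{S_3'} = 2Ind_V − Ind_{S_3} − 2Inf_{C_3} + 2Inf_Z`. [cite: BartelDokchitser2015, §2] -/
theorem indS3'_eq_combination_dihedralSix :
    (![1, 0, 0, -2, -1, 0, 0, 0, 2, 0] : Fin 10 → ℤ) = (2 : ℤ) • ![1, -1, -1, -1, 0, 0, 2, 0, 0, 0] - ![1, 0, -2, 0, -1, 0, 0, 2, 0, 0] - (2 : ℤ) • ![0, 0, 0, 0, 1, -1, 0, -1, -1, 2] + (2 : ℤ) • ![0, 1, 0, 0, 0, -1, -2, 0, 0, 2] := by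
  decide

end DihedralSixRelations

/-! ## §4 `K(D_6) = ℤInd_V ⊕ ℤInd_{S_3} ⊕ ℤInf_{C_3} ⊕ ℤInf_Z`: all imprimitive, rank `4` -/

section DihedralSixLattice

variable (𝒦 : Submodule ℤ (Fin 10 → ℤ))
  (h𝒦 : ∀ a : Fin 10 → ℤ, a ∈ 𝒦 ↔ ∑ i : Fin 10, (a i : ℂ) • indClassFun ((![⊥,
        Subgroup.zpowers (r 3 : DihedralGroup 6),
        Subgroup.zpowers (sr 0 : DihedralGroup 6),
        Subgroup.zpowers (sr 1 : DihedralGroup 6),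
        Subgroup.zpowers (r 2 : DihedralGroup 6),
        Subgroup.zpowers (r 1 : DihedralGroup 6),
        Subgroup.centralizer ({(sr 0 : DihedralGroup 6)} : Set (DihedralGroup 6)),
        Subgroup.zpowers (sr 0 : DihedralGroup 6) ⊔ Subgroup.zpowers (r 2 : DihedralGroup 6),
        Subgroup.zpowers (sr 1 : DihedralGroup 6) ⊔ Subgroup.zpowers (r 2 : DihedralGroup 6),
        ⊤] :
        Fin 10 → Subgroup (DihedralGroup 6)) i) 1 = 0)
include h𝒦

/-- **Membership in `K(D_6)` in coordinates.** [cite: BartelDokchitser2015, §1.1; §2] -/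
theorem mem_brauerRelations_dihedralSix_iff (a : Fin 10 → ℤ) :
    a ∈ 𝒦 ↔ a 3 = -2 * a 0 - a 2 ∧ a 5 = -a 0 - a 1 - a 4 ∧ a 6 = -2 * a 1 ∧ a 7 = -a 0 - a 2 - a 4 ∧
        a 8 = a 0 + a 2 - a 4 ∧ a 9 = 2 * a 0 + 2 * a 1 + 2 * a 4 :=
  (h𝒦 a).trans (sum_smul_indClassFun_dihedralSix_eq_zero_iff a)

/-- The five listed relations lie in `K(D_6)`. [cite: BartelDokchitser2015, §2] -/
theorem relations_mem_brauerRelations_dihedralSix (k : Fin 5) : (![![1, -1, -1, -1, 0, 0, 2, 0, 0, 0],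
      ![1, 0, -2, 0, -1, 0, 0, 2, 0, 0],
      ![0, 0, 0, 0, 1, -1, 0, -1, -1, 2],
      ![0, 1, 0, 0, 0, -1, -2, 0, 0, 2],
      ![1, 0, 0, -2, -1, 0, 0, 0, 2, 0]] : Fin 5 → Fin 10 → ℤ) k ∈ 𝒦 :=
  (h𝒦 _).2 (relations_mem_dihedralSix k)

/-- **Every relation of `D_6` is `(2a_1 + a_{C_2})Ind_V + (−a_1 − a_{C_2})Ind_{S_3} + (−a_1 − a_{C_2} + a_{C_3})Inf_{C_3} +
(2a_1 + a_Z + a_{C_2})Inf_Z`** — in particular imprimitive. [cite: BartelDokchitser2015, §1.1 Theorem A (table, case 4b: "(ℤ/pℤ)^{p−2}"); §2] -/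
theorem eq_combination_of_mem_brauerRelations_dihedralSix {a : Fin 10 → ℤ} (ha : a ∈ 𝒦) :
    a = (2 * a 0 + a 2) • (![1, -1, -1, -1, 0, 0, 2, 0, 0, 0] : Fin 10 → ℤ) + (-a 0 - a 2) • (![1, 0, -2, 0, -1, 0, 0, 2, 0, 0] : Fin 10 → ℤ) +
      (-a 0 - a 2 + a 4) • (![0, 0, 0, 0, 1, -1, 0, -1, -1, 2] : Fin 10 → ℤ) + (2 * a 0 + a 1 + a 2) • (![0, 1, 0, 0, 0, -1, -2, 0, 0, 2] : Fin 10 → ℤ) := by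
  obtain ⟨h3, h5, h6, h7, h8, h9⟩ := (mem_brauerRelations_dihedralSix_iff 𝒦 h𝒦 a).1 ha
  funext i
  fin_cases i <;> simp <;> omega

/-- **`K(D_6) = ℤInd_V ⊕ ℤInd_{S_3} ⊕ ℤInf_{C_3} ⊕ ℤInf_Z` — `Prim(D_6) = 0`.** [cite: BartelDokchitser2015, §1.1 Theorem A (table, case 4b with p = 2); §2] -/
theorem brauerRelations_dihedralSix_eq_span :
    𝒦 = Submodule.span ℤ {(![1, -1, -1, -1, 0, 0, 2, 0, 0, 0] : Fin 10 → ℤ), ![1, 0, -2, 0, -1, 0, 0, 2, 0, 0], ![0, 0, 0, 0, 1, -1, 0, -1, -1, 2], ![0, 1, 0, 0, 0, -1, -2, 0, 0, 2]} := by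
  refine le_antisymm (fun a ha ↦ ?_) (Submodule.span_le.2 ?_)
  · rw [eq_combination_of_mem_brauerRelations_dihedralSix 𝒦 h𝒦 ha]
    refine Submodule.add_mem _ (Submodule.add_mem _ (Submodule.add_mem _
      (Submodule.smul_mem _ _ (Submodule.subset_span (by simp)))
      (Submodule.smul_mem _ _ (Submodule.subset_span (by simp))))
      (Submodule.smul_mem _ _ (Submodule.subset_span (by simp))))
      (Submodule.smul_mem _ _ (Submodule.subset_span (by simp)))
  · rintro v (rfl | rfl | rfl | rfl)
    · exact relations_mem_brauerRelations_dihedralSix 𝒦 h𝒦 0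
    · exact relations_mem_brauerRelations_dihedralSix 𝒦 h𝒦 1
    · exact relations_mem_brauerRelations_dihedralSix 𝒦 h𝒦 2
    · exact relations_mem_brauerRelations_dihedralSix 𝒦 h𝒦 3

omit h𝒦 in
/-- The four basis vectors are linearly independent. [cite: BartelDokchitser2015, §2 ("clearly linearly independent")] -/
theorem linearIndependent_basis_dihedralSix :
    LinearIndependent ℤ (![(![1, -1, -1, -1, 0, 0, 2, 0, 0, 0] : Fin 10 → ℤ), ![1, 0, -2, 0, -1, 0, 0, 2, 0, 0], ![0, 0, 0, 0, 1, -1, 0, -1, -1, 2], ![0, 1, 0, 0, 0, -1, -2, 0, 0, 2]] : Fin 4 → Fin 10 → ℤ) := by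
  rw [Fintype.linearIndependent_iff]
  intro c hc i
  have e0 := congr_fun hc 0
  have e1 := congr_fun hc 1
  have e2 := congr_fun hc 2
  have e4 := congr_fun hc 4
  simp [Fin.sum_univ_four] at e0 e1 e2 e4
  fin_cases i <;> simp <;> omega

omit h𝒦 in
/-- The canonical lattice `K(D_6) = ker(a ↦ Σ_i a_i (1_{H_i})^G)` is the span of the four basis vectors. [cite: BartelDokchitser2015, §2] -/
theorem ker_linearCombination_indClassFun_one_dihedralSix_eq_span :
    LinearMap.ker (Fintype.linearCombination ℤ fun i : Fin 10 ↦ indClassFun ((![⊥,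
        Subgroup.zpowers (r 3 : DihedralGroup 6),
        Subgroup.zpowers (sr 0 : DihedralGroup 6),
        Subgroup.zpowers (sr 1 : DihedralGroup 6),
        Subgroup.zpowers (r 2 : DihedralGroup 6),
        Subgroup.zpowers (r 1 : DihedralGroup 6),
        Subgroup.centralizer ({(sr 0 : DihedralGroup 6)} : Set (DihedralGroup 6)),
        Subgroup.zpowers (sr 0 : DihedralGroup 6) ⊔ Subgroup.zpowers (r 2 : DihedralGroup 6),
        Subgroup.zpowers (sr 1 : DihedralGroup 6) ⊔ Subgroup.zpowers (r 2 : DihedralGroup 6),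
        ⊤] :
        Fin 10 → Subgroup (DihedralGroup 6)) i) 1) =
      Submodule.span ℤ {(![1, -1, -1, -1, 0, 0, 2, 0, 0, 0] : Fin 10 → ℤ), ![1, 0, -2, 0, -1, 0, 0, 2, 0, 0], ![0, 0, 0, 0, 1, -1, 0, -1, -1, 2], ![0, 1, 0, 0, 0, -1, -2, 0, 0, 2]} :=
  brauerRelations_dihedralSix_eq_span _ (mem_ker_linearCombination_indClassFun_one_iff _)

omit h𝒦 in
/-- **`rank K(D_6) = 4`** (on the canonical lattice) — the non-cyclic classes `V, S_3, S_3', D_6`. [cite: BartelDokchitser2015, §2] -/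
theorem finrank_ker_linearCombination_indClassFun_one_dihedralSix :
    Module.finrank ℤ (LinearMap.ker (Fintype.linearCombination ℤ fun i : Fin 10 ↦ indClassFun ((![⊥,
        Subgroup.zpowers (r 3 : DihedralGroup 6),
        Subgroup.zpowers (sr 0 : DihedralGroup 6),
        Subgroup.zpowers (sr 1 : DihedralGroup 6),
        Subgroup.zpowers (r 2 : DihedralGroup 6),
        Subgroup.zpowers (r 1 : DihedralGroup 6),
        Subgroup.centralizer ({(sr 0 : DihedralGroup 6)} : Set (DihedralGroup 6)),
        Subgroup.zpowers (sr 0 : DihedralGroup 6) ⊔ Subgroup.zpowers (r 2 : DihedralGroup 6),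
        Subgroup.zpowers (sr 1 : DihedralGroup 6) ⊔ Subgroup.zpowers (r 2 : DihedralGroup 6),
        ⊤] :
        Fin 10 → Subgroup (DihedralGroup 6)) i) 1)) = 4 := by
  rw [ker_linearCombination_indClassFun_one_dihedralSix_eq_span]
  have h := linearIndependent_basis_dihedralSix
  rw [show ({(![1, -1, -1, -1, 0, 0, 2, 0, 0, 0] : Fin 10 → ℤ), ![1, 0, -2, 0, -1, 0, 0, 2, 0, 0], ![0, 0, 0, 0, 1, -1, 0, -1, -1, 2], ![0, 1, 0, 0, 0, -1, -2, 0, 0, 2]} : Set (Fin 10 → ℤ)) =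
      Set.range (![(![1, -1, -1, -1, 0, 0, 2, 0, 0, 0] : Fin 10 → ℤ), ![1, 0, -2, 0, -1, 0, 0, 2, 0, 0], ![0, 0, 0, 0, 1, -1, 0, -1, -1, 2], ![0, 1, 0, 0, 0, -1, -2, 0, 0, 2]] : Fin 4 → Fin 10 → ℤ) by
    ext v
    simp only [Set.mem_insert_iff, Set.mem_singleton_iff, Set.mem_range]
    constructor
    · rintro (rfl | rfl | rfl | rfl)
      exacts [⟨0, rfl⟩, ⟨1, rfl⟩, ⟨2, rfl⟩, ⟨3, rfl⟩]
    · rintro ⟨i, rfl⟩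
      fin_cases i <;> simp]
  rw [finrank_span_eq_card h, Fintype.card_fin]

end DihedralSixLattice

end AbelianVariety

end Literature.AlgebraicGeometry.Motives
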